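import Literature.NumberTheory.GaloisRepresentations.LocalWeilDatum
import Literature.NumberTheory.GaloisRepresentations.LocalGaloisGroupProofs
import Literature.NumberTheory.GaloisRepresentations.AbsGaloisGroupProofs
import HarnessLib

/-!
# The Weil datum of a non-archimedean local field, VIII: a finite extension `E/F` seen inside `F̄`

For a finite extension `E/F` of non-archimedean local fields, the chosen `F`-embedding
`ι = absClosureEmbedding F E : F̄ → Ē` is an isomorphism (`absClosureEquiv` of
`AbsGaloisGroupProofs.lean`, the canonical home of `absClosureEmbedding_bijective` /
`absClosureEquiv` / `absClosureEquiv_apply`), and `E` corresponds to the finite subextension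
`E₀ = ι⁻¹(E) ⊆ F̄`, the copy of `E` embedded in `F̄` (`embField F E`, `equivEmbField : E ≃ₐ[F] E₀`).  This file relates the absolute Galois theory of `E` to that of `F` through `ι` and
the restriction `res = absGaloisRestrict F E : Γ_E → Γ_F`:

* `range res = G_{E₀}` (`absGaloisRestrict_mem_galFixing`, `exists_absGaloisRestrict_eq`):
  `res` identifies `Γ_E` with `Gal(F̄/E₀) ≤ Γ_F`;
* inertia corresponds: `res σ ∈ I_F ↔ σ ∈ I_E` (`absGaloisRestrict_mem_absInertia_iff`), from the
  identification of the absolute integers and canonical primes under `ι`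
  (`absClosureEmbedding_mem_absIntegers_iff`, `…_mem_absMaximalIdeal_iff`, file
  `LocalGaloisGroupProofs`);
* `E₀` is separable over `F` when `E` is (`embField_le_sepClosure`), so that `W_F ∩ G_{E₀}` is a
  field of the local Weil datum of `F`.

These are the Galois-theoretic inputs for reading the reciprocity system of `E` inside the Weil
datum of `F` (norm functoriality of the reciprocity map, Serre XIII §4 Prop. 10).

## References

* J. Tate, *Number theoretic background*, Corvallis 1979, (1.4.5)–(1.4.6). [TateCorvallis1979]
* J.-P. Serre, *Local Fields*, Ch. I §7 Prop. 22, Ch. II §2. [SerreLocalFields1979]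
-/

noncomputable section

open Field IsNonarchimedeanLocalField ValuativeRel
open scoped Pointwise Valued

namespace Literature.NumberTheory.GaloisRepresentations

namespace LocalWeilDatum

open GaloisRepresentations.IsNonarchimedeanLocalField

attribute [local instance] absClosureAlgebra absClosure_isScalarTower

section Algebraic

variable (F E : Type*) [Field F] [Field E] [Algebra F E]

/-- **`E₀ = ι⁻¹(E) ⊆ F̄`**: the subextension of `F̄/F` corresponding to `E ⊆ Ē` under the
embedding `ι` (an isomorphism for `E/F` algebraic). [folklore] -/
def embField : IntermediateField F (AlgebraicClosure F) :=
  ((IsScalarTower.toAlgHom F E (AlgebraicClosure E)).fieldRange).comap (absClosureEmbedding F E)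

/-- Membership in `E₀`: `a ∈ E₀ ↔ ι a ∈ E`. [folklore] -/
theorem mem_embField_iff {a : AlgebraicClosure F} :
    a ∈ embField F E ↔ ∃ x : E, algebraMap E (AlgebraicClosure E) x = absClosureEmbedding F E a := by
  change absClosureEmbedding F E a ∈ (IsScalarTower.toAlgHom F E (AlgebraicClosure E)).fieldRange ↔ _
  rw [AlgHom.mem_fieldRange]
  rfl

variable [Algebra.IsAlgebraic F E]

/-- The map `E → E₀`, `x ↦ ι⁻¹ x`. [folklore] -/
def toEmbField : E →ₐ[F] embField F E where
  toFun x := ⟨(absClosureEquiv F E).symm (algebraMap E (AlgebraicClosure E) x),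
    (mem_embField_iff F E).mpr ⟨x, by rw [absClosureEmbedding_absClosureEquiv_symm]⟩⟩
  map_one' := Subtype.ext (by simp)
  map_mul' x y := Subtype.ext (by simp)
  map_zero' := Subtype.ext (by simp)
  map_add' x y := Subtype.ext (by simp)
  commutes' r := Subtype.ext (by
    change (absClosureEquiv F E).symm (algebraMap E (AlgebraicClosure E) (algebraMap F E r)) =
      algebraMap F (AlgebraicClosure F) r
    rw [← IsScalarTower.algebraMap_apply, AlgEquiv.commutes])

/-- `ι (toEmbField x) = x`. [folklore] -/
@[simp]
theorem absClosureEmbedding_toEmbField (x : E) :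
    absClosureEmbedding F E ((toEmbField F E x : embField F E) : AlgebraicClosure F) =
      algebraMap E (AlgebraicClosure E) x :=
  absClosureEmbedding_absClosureEquiv_symm F E _

/-- **`E ≃ₐ[F] E₀`**. [folklore] -/
def equivEmbField : E ≃ₐ[F] embField F E :=
  AlgEquiv.ofBijective (toEmbField F E)
    ⟨(toEmbField F E).toRingHom.injective, fun a => by
      obtain ⟨x, hx⟩ := (mem_embField_iff F E).mp a.2
      refine ⟨x, Subtype.ext ?_⟩
      apply (absClosureEmbedding_bijective F E).1
      rw [absClosureEmbedding_toEmbField, hx]⟩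

/-- `ι (equivEmbField x) = x`. [folklore] -/
@[simp]
theorem absClosureEmbedding_equivEmbField (x : E) :
    absClosureEmbedding F E ((equivEmbField F E x : embField F E) : AlgebraicClosure F) =
      algebraMap E (AlgebraicClosure E) x :=
  absClosureEmbedding_toEmbField F E x

/-- `ι a = x` for `a ∈ E₀` corresponding to `x`. [folklore] -/
theorem absClosureEmbedding_coe_eq (a : embField F E) :
    absClosureEmbedding F E (a : AlgebraicClosure F) = algebraMap E (AlgebraicClosure E) ((equivEmbField F E).symm a) := by
  conv_lhs => rw [← (equivEmbField F E).apply_symm_apply a]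
  exact absClosureEmbedding_equivEmbField F E _

/-- `E₀/F` is finite when `E/F` is. [folklore] -/
theorem finiteDimensional_embField [FiniteDimensional F E] : FiniteDimensional F (embField F E) :=
  LinearEquiv.finiteDimensional (equivEmbField F E).toLinearEquiv

/-- `E₀ ⊆ F^sep` when `E/F` is separable. [folklore] -/
theorem embField_le_sepClosure [Algebra.IsSeparable F E] : embField F E ≤ sepClosure F := by
  rw [le_separableClosure_iff]
  exact Algebra.IsSeparable.of_algHom F E (equivEmbField F E).symm.toAlgHom

/-! ### `Γ_E ≅ Gal(F̄/E₀)` under restriction -/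

/-- The restriction of an `E`-automorphism of `Ē` fixes `E₀`: `range res ≤ G_{E₀}` (explicit form,
for the embedding `x ↦ ι⁻¹ x`, of one direction of `ArtinRestriction.exists_mem_range_absGaloisRestrict_iff`).
[cite: TateCorvallis1979, (1.4.5)] -/
theorem absGaloisRestrict_mem_galFixing (σ : absoluteGaloisGroup E) :
    absGaloisRestrict F E σ ∈ galFixing F (embField F E) := by
  rw [mem_galFixing_iff]
  intro a ha
  obtain ⟨x, hx⟩ := (mem_embField_iff F E).mp ha
  apply (absClosureEmbedding_bijective F E).1
  rw [absGaloisRestrict_apply_smul, ← hx, absoluteGaloisGroup.smul_def]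
  exact (absoluteGaloisGroup.toAlgEquiv E σ).commutes x

/-- **Every automorphism of `F̄` over `E₀` is the restriction of an automorphism of `Ē` over `E`**:
`range res = G_{E₀}` (explicit form of the other direction of
`ArtinRestriction.exists_mem_range_absGaloisRestrict_iff`, same construction `ι ∘ γ ∘ ι⁻¹`).
[cite: TateCorvallis1979, (1.4.5)] -/
theorem exists_absGaloisRestrict_eq {γ : absoluteGaloisGroup F} (hγ : γ ∈ galFixing F (embField F E)) :
    ∃ σ : absoluteGaloisGroup E, absGaloisRestrict F E σ = γ := by
  -- `ι ∘ γ ∘ ι⁻¹` as a ring automorphism of `Ē`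
  let ρ : AlgebraicClosure E ≃+* AlgebraicClosure E :=
    ((absClosureEquiv F E).symm.toRingEquiv.trans (absoluteGaloisGroup.toAlgEquiv F γ).toRingEquiv).trans
      (absClosureEquiv F E).toRingEquiv
  have hρ : ∀ y, ρ y = absClosureEmbedding F E (γ • (absClosureEquiv F E).symm y) := fun y => rfl
  -- it is `E`-linear
  have hρE : ∀ x : E, ρ (algebraMap E (AlgebraicClosure E) x) = algebraMap E (AlgebraicClosure E) x := by
    intro x
    rw [hρ, show (absClosureEquiv F E).symm (algebraMap E (AlgebraicClosure E) x) =
      ((toEmbField F E x : embField F E) : AlgebraicClosure F) from rfl,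
      (mem_galFixing_iff F).mp hγ _ (toEmbField F E x).2, absClosureEmbedding_toEmbField]
  let σ' : AlgebraicClosure E ≃ₐ[E] AlgebraicClosure E := AlgEquiv.ofRingEquiv (f := ρ) hρE
  refine ⟨(absoluteGaloisGroup.toAlgEquiv E).symm σ', ?_⟩
  apply AlgEquiv.ext
  intro a
  change absGaloisRestrict F E ((absoluteGaloisGroup.toAlgEquiv E).symm σ') • a = γ • a
  apply (absClosureEmbedding_bijective F E).1
  rw [absGaloisRestrict_apply_smul, absoluteGaloisGroup.toAlgEquiv_symm_apply]
  change ρ (absClosureEmbedding F E a) = _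
  rw [hρ, absClosureEquiv_symm_absClosureEmbedding]

end Algebraic

/-! ### Inertia under restriction -/

section Local

variable (F E : Type*) [Field F] [ValuativeRel F] [TopologicalSpace F] [IsNonarchimedeanLocalField F]
  [Field E] [ValuativeRel E] [TopologicalSpace E] [IsNonarchimedeanLocalField E]
  [Algebra F E] [ValuativeExtension F E]

/-- **Inertia corresponds under restriction**: `res σ ∈ I_F ↔ σ ∈ I_E` for `σ ∈ Γ_E` (`E/F` finite
extension of non-archimedean local fields): `ι` identifies the absolute integers and the canonical
primes of `F̄` and `Ē`, and `ι (res σ • a) = σ • ι a`.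
[cite: SerreLocalFields1979, Ch. I §7 Prop. 22; TateCorvallis1979, (1.4.5)] -/
theorem absGaloisRestrict_mem_absInertia_iff [Algebra.IsAlgebraic F E] (σ : absoluteGaloisGroup E) :
    absGaloisRestrict F E σ ∈ absInertia F ↔ σ ∈ absInertia E := by
  have hι := absClosureEmbedding_bijective F E
  constructor
  · intro hσ
    rw [mem_absInertia_iff]
    intro x
    obtain ⟨a, ha⟩ := hι.2 (x : AlgebraicClosure E)
    have haint : a ∈ absIntegers 𝒪[F] F :=
      (absClosureEmbedding_mem_absIntegers_iff (E := E) a).mp (by rw [ha]; exact x.2)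
    have hzP := mem_absInertia_iff.mp hσ ⟨a, haint⟩
    have hzint : absClosureEmbedding F E
        ((absGaloisRestrict F E σ • (⟨a, haint⟩ : absIntegers 𝒪[F] F) - ⟨a, haint⟩ : absIntegers 𝒪[F] F) :
          AlgebraicClosure F) ∈ absIntegers 𝒪[E] E :=
      (absClosureEmbedding_mem_absIntegers_iff (E := E) _).mpr (Subtype.coe_prop _)
    have h1 := (absClosureEmbedding_mem_absMaximalIdeal_iff _ hzint).mpr hzP
    have heq : (⟨_, hzint⟩ : absIntegers 𝒪[E] E) = σ • x - x := Subtype.ext (by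
      simp [integralClosure.coe_smul, absGaloisRestrict_apply_smul, ha])
    rwa [heq] at h1
  · intro hσ
    rw [mem_absInertia_iff]
    intro y
    have hyint : absClosureEmbedding F E y ∈ absIntegers 𝒪[E] E :=
      (absClosureEmbedding_mem_absIntegers_iff (E := E) _).mpr y.2
    have h1 := mem_absInertia_iff.mp hσ ⟨_, hyint⟩
    have hzint : absClosureEmbedding F E ((absGaloisRestrict F E σ • y - y : absIntegers 𝒪[F] F) : AlgebraicClosure F) ∈
        absIntegers 𝒪[E] E :=
      (absClosureEmbedding_mem_absIntegers_iff (E := E) _).mpr (Subtype.coe_prop _)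
    rw [← absClosureEmbedding_mem_absMaximalIdeal_iff _ hzint]
    have heq : (⟨_, hzint⟩ : absIntegers 𝒪[E] E) =
        σ • (⟨_, hyint⟩ : absIntegers 𝒪[E] E) - ⟨_, hyint⟩ := Subtype.ext (by
      simp [integralClosure.coe_smul, absGaloisRestrict_apply_smul])
    rw [heq]
    exact h1

end Local

end LocalWeilDatum

end Literature.NumberTheory.GaloisRepresentations
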